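import Summits.QuantumFields.YangMills.Theorems.BalabanUVNodesK0P0CarrierPinsN10
import Summits.QuantumFields.YangMills.Theorems.BalabanUVNodesPortU8TwoVolume
import HarnessLib

/-!
# K0 ⟷ N10 — THE BRIDGE `B` OF THE NODE HOLDS: def-Y's DISPLAYED letters `P0ToEntryLettersBridge` (B-decay), `P0ToRefAccBridge` (B-acc), `P0ToN10KernelBridge = B-decay ∧ B-acc`
# INHABITED (◇ lens-1 v22 (N1)∕(B); ★★★ №640 (2)(b) «proof later by a porter», №645 (2) (O2)+(O3), №651 (2) (O4′)): (P4)'s Schur-bounded PIECES ⟹ module 32's ENTRY letters of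
# `Δ₀ := TC∣window` (`ρΔ = (δ₀ − log C_anim)∕cD`, `BΔ = c₀·C_anim`); (P5ᶜ) ⟹ `γ₀`-accretivity of the `σ = 0` kernel `[comp a = comp b]·½(T + Tᵀ)`

Cell `pub-ymgap` ∕ node-O cover, porter lineage `ymgap-nodeO-port-PTB-1` (g11).  `--kind proof --supports stmt-QuantumFields-27930 --as helper` (the bridge serves
`stub_FEpolymerActivitiesReg`'s future line; §1∕§3 are abstract and reusable by the K0ᴬ ⟨27238⟩ ∕ N10 ENTRY road — one lane flag only); count-neutral.
[I] = [Balaban1987RG1]; [II] = [Balaban1988RG2Cluster]; [13] = [Balaban1985BackgroundPropagators]; [15] = [Balaban1985Variational].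

WHAT IS PROVED (sorry-free; no definition; standard axioms).
* §1 (O3, abstract; any finite catalogue) ★★ `sum_pieces_le_entryBound` — THE PIECE → ENTRY PORTER: pieces `≤ c₀e^{−δ₀d(Y)}` on the domains seen at a pair, distance
  domination with slack `t ≤ cD·d(Y) + cS`, a rate above the animal rate (`κ₀ < δ₀`) and the (1.26) family sum `≤ K₀` over a superset give `Σ pieces ≤ c₀·K₀·e^{ρ·cS}·e^{−ρ·t}`, `ρ = (δ₀−κ₀)∕cD`.
* §2 (O2, the record) ★★★ `p0ToEntryLettersBridge_holds` — def-Y's DISPLAYED letter ✓`K0P0CarrierPins.P0ToEntryLettersBridge F …` INHABITED, exactly its type (edition v3 of the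
  letter: the two consumer-free antecedents `McGuard F Mc`, `0 ≤ c₀` of this lineage's pre-cut note and ◆ CRIT-1's (N-4) slack `cS` with `BΔ = c₀·C_anim·e^{ρΔ·cS}`):
  `decay` = (P4) sum + support (the entry is the sum of the pieces `T_Y`, `Y ∋ i, j`) + (P4) Schur row at the chart's point (`ChartInRecordSpace`) + §1 with `DistDominated`,
  `AnimalRateRow δ₀` and the record's (1.26) ✓`ineq126_recordDomSys` keyed on the ONE cube of the first index (✓`PortU8.mem_domSites_iff` — where the tiling guard `McGuard`
  enters); `holo` = (P4)-analyticity at `cfg u ∈ U^c(Y)` ∘ the chart's differentiability for `Y ∋ i, j`, the other pieces vanishing identically; `B_nonneg` =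
  `0 ≤ c₀·animConst·e^{ρΔ cS}` (where `0 ≤ c₀` enters: `RawEntryLetters` asserts it even on an empty window).
* §3 (O4′, abstract; any finite window) `re_quadratic_symm`, ★★ `re_blockSymm_ge` — if `Re Q_T(w) ≥ γ₀‖w‖²` for EVERY `w`, the same-component symmetrisation
  `[comp a = comp b]·½(T_ab + T_ba)` is `γ₀`-accretive (component indicator vectors and their conjugates; `Σ_m ‖v^m‖² = ‖v‖²`).
* §4 (O4′, the record) `decoratedOp_one_zero_apply` (the lane's ✓`Node00.decoratedOp Δ₀ J 1` at `σ = 0`, entrywise: `[J(a,b) = ∅]·½Δ₀_ab + [J(b,a) = ∅]·½Δ₀_ba`, since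
  `∏_{k ∈ J ω} 0 = [J ω = ∅]`); ★★★ `p0ToRefAccBridge_holds` — def-Y's ✓`K0P0CarrierPins.P0ToRefAccBridge F …` INHABITED, exactly its type: the kernel is `[comp a = comp b]·½(T + Tᵀ)`
  with `T = Σ_{Y ⊆ Xref} T_Y(cfg 0)∣window` ((P4) sum + the letter's conditioning hypothesis), and §3 reduces `γ₀`-accretivity to (P5ᶜ) at `(X, φ) := (Xref, cfg 0)` on the
  `κ`-lifts `Function.extend κ w 0` (supported in `Xref` by the letter's `IdxInDom` hypothesis; sums re-indexed by injectivity); ★★ `p0ToN10KernelBridge_holds := ⟨§2, §4⟩`.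

TYPING REMARK (★★★ №651 (1), verbatim).  def-Y's `DifferentiableOn ℂ cfg` (§3 of ✓`…K0P0CarrierPinsN10`) elaborates WITHOUT a matrix norm because Mathlib's `DifferentiableOn`
needs only the TVS structure of the codomain `Sect2.CPair … (MatA 2)` (Pi topology), while ▶ PT-A's (P4) `AnalyticAt` (✓`…K0RecordFormatNamesP0C`) lives under the scoped
`Matrix.Norms.L2Operator` instances; this file composes the two under that scope — the L2-operator uniformity is Mathlib's forgetful-inheritance copy of the Pi one, so
`DifferentiableAt.comp_differentiableWithinAt` typechecks (kernel-confirmed).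

HONEST SCOPE.  Bookkeeping of finite sums, exponentials and quadratic forms over DISPLAYED letters: the antecedent `P0CarrierClauses …` (▶ PT-A's (P1)–(P5ᶜ) = `stub_P0C`'s
body) is inhabited NOWHERE; nothing of [I] (2.11)–(2.12), [II] (2.5)–(2.14), [13] Thm 3.10, [15] Prop. 9 is proved here — the clauses FORMAT module 32's binder block, no more;
`stub_P0C` ∕ `stub_FEpolymerActivitiesReg` ∕ ⟨27930⟩ OPEN (1∕7, v3.8); K0ᴬ∕K1ᴬ∕K3ᴬ OPEN; NODE O 0∕1; COUNT∕K unmoved; finite `𝕋⁴_{L^K}` at fixed ε — NOT continuum ∕ ℝ⁴ ∕ OS;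
**the Yang–Mills mass gap (Clay) is NOT proved by any of this.**  No `sorry`, no `def`, no `instance ∕ notation`.
-/

set_option autoImplicit false

noncomputable section

namespace Summit.QuantumFields.YangMills.Theorems.K0P0ToEntryLettersBridgeHolds

open scoped BigOperators Matrix Matrix.Norms.L2Operator
open Metric
open Literature.MathematicalPhysics.QuantumFieldTheory.Balaban1983to89
open Literature.MathematicalPhysics.QuantumFieldTheory.Balaban1983to89.Node00
open Literature.MathematicalPhysics.QuantumFieldTheory.Balaban1983to89.T4Continuum (T4Family)
open Literature.MathematicalPhysics.QuantumFieldTheory.Balaban1983to89.TreeLengthTorus (TPt)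
open Literature.MathematicalPhysics.QuantumFieldTheory.Balaban1983to89.B14.Eq213MaximalDomains (side)
open B13EntrywiseWalks (RawEntryLetters)
open B9Thm37GlueTorus (tdist1)
open Summit.QuantumFields.YangMills.Theorems.K0RecordFormatNames
open Summit.QuantumFields.YangMills.Theorems.K0P0CarrierPins
open Summit.QuantumFields.YangMills.Theorems.PortU8 (mem_domSites_iff)

/-! ## §1  (O3) The PIECE → ENTRY porter, abstract: Schur-bounded pieces over a catalogue with the (1.26) family sum give one decaying entry -/

section PieceToEntry

variable {Dom : Type*}

/-- ★★ **PIECE → ENTRY (abstract)** — ◇ lens-1 v22 (N1)'s S-size porter with `ρΔ := (δ₀ − κ₀)∕cD`, `BΔ := c₀·K₀`: if every piece seen at the pair is bounded by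
`c₀·e^{−δ₀·d(Y)}`, every such `Y` has `t ≤ cD·d(Y)` (distance domination), the rate beats the animal rate (`κ₀ < δ₀`) and the catalogue's (1.26) family sum over a
superset `T ⊇ S` is at most `K₀`, then the sum of the pieces is at most `c₀·K₀·e^{−ρΔ·t}`.  Pure bookkeeping of exponentials: `e^{−δ₀d} = e^{−κ₀d}·e^{−(δ₀−κ₀)d} ≤ e^{−κ₀d}·e^{−ρΔ t}`.
[cite: Balaban1987RG1, (1.21) p.264, (2.11)–(2.12) pp.267–268; Balaban1988RG2Cluster, (1.26) p.8; Balaban1985BackgroundPropagators, (3.108) p.416] -/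
theorem sum_pieces_le_entryBound (S T : Finset Dom) (hST : S ⊆ T) (piece d : Dom → ℝ) {c₀ δ₀ κ₀ K₀ cD cS t : ℝ}
    (hc₀ : 0 ≤ c₀) (hκ : κ₀ < δ₀) (hcD : 0 < cD)
    (hpiece : ∀ Y ∈ S, piece Y ≤ c₀ * Real.exp (-(δ₀ * d Y))) (hdist : ∀ Y ∈ S, t ≤ cD * d Y + cS)
    (h126 : ∑ Y ∈ T, Real.exp (-(κ₀ * d Y)) ≤ K₀) :
    ∑ Y ∈ S, piece Y ≤ c₀ * K₀ * Real.exp ((δ₀ - κ₀) / cD * cS) * Real.exp (-((δ₀ - κ₀) / cD * t)) := by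
  have hρ : 0 ≤ (δ₀ - κ₀) / cD := div_nonneg (sub_pos.2 hκ).le hcD.le
  have hpt : ∀ Y ∈ S, piece Y ≤
      c₀ * (Real.exp (-(κ₀ * d Y)) * (Real.exp ((δ₀ - κ₀) / cD * cS) * Real.exp (-((δ₀ - κ₀) / cD * t)))) := by
    intro Y hY
    have h1 : (δ₀ - κ₀) / cD * t - (δ₀ - κ₀) / cD * cS ≤ (δ₀ - κ₀) * d Y := by
      have h0 : (δ₀ - κ₀) / cD * (t - cS) ≤ (δ₀ - κ₀) / cD * (cD * d Y) :=
        mul_le_mul_of_nonneg_left (by linarith [hdist Y hY]) hρ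
      calc (δ₀ - κ₀) / cD * t - (δ₀ - κ₀) / cD * cS = (δ₀ - κ₀) / cD * (t - cS) := by ring
        _ ≤ (δ₀ - κ₀) / cD * (cD * d Y) := h0
        _ = (δ₀ - κ₀) * d Y := by field_simp
    have hsplit : Real.exp (-(δ₀ * d Y)) = Real.exp (-(κ₀ * d Y)) * Real.exp (-((δ₀ - κ₀) * d Y)) := by
      rw [← Real.exp_add]; congr 1; ring
    have hexp2 : Real.exp (-((δ₀ - κ₀) * d Y)) ≤ Real.exp ((δ₀ - κ₀) / cD * cS) * Real.exp (-((δ₀ - κ₀) / cD * t)) := by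
      rw [← Real.exp_add]; exact Real.exp_le_exp.2 (by linarith)
    have hp := hpiece Y hY
    rw [hsplit] at hp
    exact le_trans hp (mul_le_mul_of_nonneg_left (mul_le_mul_of_nonneg_left hexp2 (Real.exp_pos _).le) hc₀)
  have hE : 0 ≤ c₀ * (Real.exp ((δ₀ - κ₀) / cD * cS) * Real.exp (-((δ₀ - κ₀) / cD * t))) :=
    mul_nonneg hc₀ (mul_nonneg (Real.exp_pos _).le (Real.exp_pos _).le)
  calc ∑ Y ∈ S, piece Y
      ≤ ∑ Y ∈ S, c₀ * (Real.exp (-(κ₀ * d Y)) * (Real.exp ((δ₀ - κ₀) / cD * cS) * Real.exp (-((δ₀ - κ₀) / cD * t)))) :=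
        Finset.sum_le_sum hpt
    _ = c₀ * (Real.exp ((δ₀ - κ₀) / cD * cS) * Real.exp (-((δ₀ - κ₀) / cD * t))) * ∑ Y ∈ S, Real.exp (-(κ₀ * d Y)) := by
        rw [Finset.mul_sum]
        exact Finset.sum_congr rfl fun Y _ => by ring
    _ ≤ c₀ * (Real.exp ((δ₀ - κ₀) / cD * cS) * Real.exp (-((δ₀ - κ₀) / cD * t))) * ∑ Y ∈ T, Real.exp (-(κ₀ * d Y)) :=
        mul_le_mul_of_nonneg_left (Finset.sum_le_sum_of_subset_of_nonneg hST fun _ _ _ => (Real.exp_pos _).le) hE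
    _ ≤ c₀ * (Real.exp ((δ₀ - κ₀) / cD * cS) * Real.exp (-((δ₀ - κ₀) / cD * t))) * K₀ := mul_le_mul_of_nonneg_left h126 hE
    _ = c₀ * K₀ * Real.exp ((δ₀ - κ₀) / cD * cS) * Real.exp (-((δ₀ - κ₀) / cD * t)) := by ring

end PieceToEntry

/-! ## §2  (O2) The B-decay bridge `P0ToEntryLettersBridge` HOLDS -/

/-! The letter's parameters (▶ PT-A's `P0CarrierClauses` binders), shared by §2 and §4. -/
variable (F : T4Family) (a₀ δ₀ c₀ γ₀ γ₁ : ℝ) (Mc : ℕ) (α₀ α₁ ε₂₉ : ℝ) (k : ℕ)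
  (TC : (n : ℕ) → Sect2.CPair (F.P (recordK₀ F Mc k + n)) (MatA 2) →
      FluctIdx F k (recordK₀ F Mc k + n) → FluctIdx F k (recordK₀ F Mc k + n) → ℂ)
  (TY : (n : ℕ) → (recordDomSys F Mc k (recordK₀ F Mc k + n)).Dom → Sect2.CPair (F.P (recordK₀ F Mc k + n)) (MatA 2) →
      FluctIdx F k (recordK₀ F Mc k + n) → FluctIdx F k (recordK₀ F Mc k + n) → ℂ)
  (TZY : Finset (Fin 4 → ℤ) → IntBondCfg → ((Fin 4 → ℤ) × Fin 4) × Fin 3 → ((Fin 4 → ℤ) × Fin 4) × Fin 3 → ℂ)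
  (AdM : (n : ℕ) → (Site (F.P (recordK₀ F Mc k + n)) 0 → (MatA 2)ˣ) →
      Matrix (FluctIdx F k (recordK₀ F Mc k + n)) (FluctIdx F k (recordK₀ F Mc k + n)) ℂ)
  (AdZ : ((Fin 4 → ℤ) → (MatA 2)ˣ) → (Fin 4 → ℤ) × Fin 4 → Matrix (Fin 3) (Fin 3) ℂ)

/-- ★★★ **THE B-DECAY BRIDGE HOLDS** (def-Y's letter, edition v3: the cube guard `McGuard F Mc` and `0 ≤ c₀` are the letter's own first and fourth antecedents — both held in
`P0HolExtAtRecord`'s prefix — and `DistDominated` carries the additive slack `cS`, paid by `e^{ρΔ·cS}` in `entryConst`): for the window's `Δ₀ := TC n∣window` along `cfg`, `RawEntryLetters … R (entryRate δ₀ cD) (entryConst c₀)`.  `decay`: (P4) sum + support reduce the entry to the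
pieces `Y ∋ i, j`; (P4) Schur row ⟹ `‖T_Y,ij‖ ≤ c₀e^{−δ₀d(Y)}` at the chart's point (`ChartInRecordSpace`); §1 with `DistDominated`, `AnimalRateRow δ₀` and the record's (1.26)
✓`ineq126_recordDomSys` keyed on the ONE cube of the first index (✓`PortU8.mem_domSites_iff`, tiled range).  `holo`: for `Y ∋ i, j` (P4)-analyticity at `cfg u ∈ U^c(Y)` composed
with the chart's differentiability; the other pieces vanish identically.  `B_nonneg`: `0 ≤ c₀·animConst`.
[cite: Balaban1987RG1, (1.21) p.264, (2.11)–(2.12) pp.267–268, p.257; Balaban1988RG2Cluster, (1.26) p.8, (2.5) p.12; Balaban1985BackgroundPropagators, Thm 3.10 (3.107)–(3.108) p.416] -/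
theorem p0ToEntryLettersBridge_holds :
    P0ToEntryLettersBridge F a₀ δ₀ c₀ γ₀ γ₁ Mc α₀ α₁ ε₂₉ k TC TY TZY AdM AdZ := by
  unfold P0ToEntryLettersBridge
  intro hMc hP hrate hc₀ n ν Nf _ E _ _ q _ _ κ loc cfg R cD cS hcD _ hChart hDist
  classical
  obtain ⟨-, -, -, -, -, -, -, h8, h9, -, h11, -, -⟩ := hP
  have hK : recordK₀ F Mc k ≤ recordK₀ F Mc k + n := Nat.le_add_right _ _
  have hrate' : animRate < δ₀ := hrate
  have hanim := animRate_nonneg_animConst_pos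
  refine ⟨fun u hu i j => ?_, fun i j => ?_, mul_nonneg (mul_nonneg hc₀ hanim.2.le) (Real.exp_pos _).le⟩
  · -- decay: the pieces seen at the pair
    set S : Finset (recordDomSys F Mc k (recordK₀ F Mc k + n)).Dom :=
      Finset.univ.filter (fun Y => IdxInDom F Mc k (recordK₀ F Mc k + n) (κ i) Y ∧ IdxInDom F Mc k (recordK₀ F Mc k + n) (κ j) Y) with hS
    have hmemS : ∀ Y ∈ S, IdxInDom F Mc k (recordK₀ F Mc k + n) (κ i) Y ∧ IdxInDom F Mc k (recordK₀ F Mc k + n) (κ j) Y :=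
      fun Y hY => (Finset.mem_filter.1 hY).2
    have hsumS : ∑ Y, TY n Y (cfg u) (κ i) (κ j) = ∑ Y ∈ S, TY n Y (cfg u) (κ i) (κ j) := by
      refine (Finset.sum_subset (Finset.filter_subset _ _) fun Y _ hY => ?_).symm
      exact h9 n Y (cfg u) (κ i) (κ j) (not_and_or.1 fun h => hY (Finset.mem_filter.2 ⟨Finset.mem_univ _, h⟩))
    -- the ONE cube of the first index and the (1.26) family over it
    set c : TPt (F.P (recordK₀ F Mc k + n)).d (Sect2.domCount (F.P (recordK₀ F Mc k + n)) Mc (k + 1)) :=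
      fun l => ((((B15DeterminingSets.embIter k (κ i).1.src) l).val / side (F.P (recordK₀ F Mc k + n)).L Mc (k + 1) : ℕ) :
        ZMod (Sect2.domCount (F.P (recordK₀ F Mc k + n)) Mc (k + 1))) with hc
    have hsub : S ⊆ Finset.univ.filter (fun Y : (recordDomSys F Mc k (recordK₀ F Mc k + n)).Dom => c ∈ (Y.1 : Finset _)) := fun Y hY =>
      Finset.mem_filter.2 ⟨Finset.mem_univ _, (mem_domSites_iff hMc hK Y _).1 (hmemS Y hY).1⟩
    have h126 : ∑ Y ∈ Finset.univ.filter (fun Y : (recordDomSys F Mc k (recordK₀ F Mc k + n)).Dom => c ∈ (Y.1 : Finset _)),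
        Real.exp (-(animRate * (recordDomSys F Mc k (recordK₀ F Mc k + n)).dj Y)) ≤ animConst :=
      ineq126_recordDomSys F Mc k (recordK₀ F Mc k + n) c
    -- (P4): entry ≤ Schur row ≤ c₀ e^{-δ₀ d(Y)} at the chart's point
    have hpiece : ∀ Y ∈ S, ‖TY n Y (cfg u) (κ i) (κ j)‖ ≤ c₀ * Real.exp (-(δ₀ * (recordDomSys F Mc k (recordK₀ F Mc k + n)).dj Y)) := by
      intro Y hY
      obtain ⟨hYi, hYj⟩ := hmemS Y hY
      exact le_trans (Finset.single_le_sum (f := fun j' => ‖TY n Y (cfg u) (κ i) j'‖) (fun _ _ => norm_nonneg _) (Finset.mem_univ (κ j)))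
        ((h11 n Y (cfg u) (hChart.2 u hu Y i j hYi hYj)).2.1 (κ i))
    have hdist : ∀ Y ∈ S, tdist1 Nf (loc i) (loc j) ≤ cD * (recordDomSys F Mc k (recordK₀ F Mc k + n)).dj Y + cS :=
      fun Y hY => hDist Y i j (hmemS Y hY).1 (hmemS Y hY).2
    rw [deltaOfTC_apply, h8, hsumS]
    calc ‖∑ Y ∈ S, TY n Y (cfg u) (κ i) (κ j)‖
        ≤ ∑ Y ∈ S, ‖TY n Y (cfg u) (κ i) (κ j)‖ := norm_sum_le _ _
      _ ≤ c₀ * animConst * Real.exp ((δ₀ - animRate) / cD * cS) * Real.exp (-((δ₀ - animRate) / cD * tdist1 Nf (loc i) (loc j))) :=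
          sum_pieces_le_entryBound S _ hsub (fun Y => ‖TY n Y (cfg u) (κ i) (κ j)‖) _ hc₀ hrate' hcD hpiece hdist h126
      _ = entryConst c₀ (entryRate δ₀ cD) cS * Real.exp (-(entryRate δ₀ cD * tdist1 Nf (loc i) (loc j))) := rfl
  · -- holo
    have hfun : (fun u => deltaOfTC (TC n) cfg κ u i j) =
        fun u => ∑ Y, TY n Y (cfg u) (κ i) (κ j) := funext fun u => by rw [deltaOfTC_apply, h8]
    rw [hfun]
    refine DifferentiableOn.fun_sum fun Y _ => ?_
    by_cases hY : IdxInDom F Mc k (recordK₀ F Mc k + n) (κ i) Y ∧ IdxInDom F Mc k (recordK₀ F Mc k + n) (κ j) Y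
    · intro u hu
      exact (((h11 n Y (cfg u) (hChart.2 u hu Y i j hY.1 hY.2)).1 (κ i) (κ j)).differentiableAt).comp_differentiableWithinAt u
        (hChart.1 u hu)
    · have hz : (fun u => TY n Y (cfg u) (κ i) (κ j)) = fun _ => (0 : ℂ) :=
        funext fun u => h9 n Y (cfg u) (κ i) (κ j) (not_and_or.1 hY)
      rw [hz]
      exact differentiableOn_const _


/-! ## §3  (O4′, abstract) Block-symmetrised quadratic forms: coercivity on every vector ⟹ coercivity of the same-component symmetrisation -/

section BlockSymm

variable {q : Type} [Fintype q]

/-- **Re of a symmetrised quadratic form**: `Re Σ_{a,b} w̄_a·(h·(T_ab + T_ba))·w_b = h·Re Q_T(w) + h·Re Q_T(w̄)` for real `h`, where `Q_T(w) = Σ_{a,b} w̄_a T_ab w_b` and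
`w̄ = star ∘ w` — the transposed half is the form at the conjugate vector. [folklore] -/
theorem re_quadratic_symm (T : q → q → ℂ) (h : ℝ) (w : q → ℂ) :
    (∑ a, ∑ b, star (w a) * ((h : ℂ) * (T a b + T b a)) * w b).re =
      h * (∑ a, ∑ b, star (w a) * T a b * w b).re + h * (∑ a, ∑ b, star (star (w a)) * T a b * star (w b)).re := by
  have hsplit : ∑ a, ∑ b, star (w a) * ((h : ℂ) * (T a b + T b a)) * w b =
      (h : ℂ) * (∑ a, ∑ b, star (w a) * T a b * w b) + (h : ℂ) * (∑ a, ∑ b, star (w a) * T b a * w b) := by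
    rw [Finset.mul_sum, Finset.mul_sum, ← Finset.sum_add_distrib]
    refine Finset.sum_congr rfl fun a _ => ?_
    rw [Finset.mul_sum, Finset.mul_sum, ← Finset.sum_add_distrib]
    exact Finset.sum_congr rfl fun b _ => by ring
  have hswap : ∑ a, ∑ b, star (w a) * T b a * w b = ∑ a, ∑ b, star (star (w a)) * T a b * star (w b) := by
    rw [Finset.sum_comm]
    refine Finset.sum_congr rfl fun a _ => Finset.sum_congr rfl fun b _ => ?_
    rw [star_star]; ring
  rw [hsplit, hswap, Complex.add_re, Complex.re_ofReal_mul, Complex.re_ofReal_mul]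

/-- ★★ **COERCIVITY OF THE SAME-COMPONENT SYMMETRISATION** (abstract (O4′)): if `Re Q_T(w) ≥ γ₀‖w‖²` for EVERY `w : q → ℂ`, then the kernel
`K_ab = [comp a = comp b]·½(T_ab + T_ba)` is `γ₀`-accretive: `γ₀‖v‖² ≤ Re Σ_a v̄_a (K v)_a`.  Per component value `m` the indicator vector `v^m` and its conjugate each
get `γ₀‖v^m‖²` from the hypothesis (`re_quadratic_symm`), and `Σ_m ‖v^m‖² = ‖v‖²`. [cite: Balaban1988RG2Cluster, p.15 («for the pair (U′, 0) the operators are symmetric, and the measure is positive»)] -/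
theorem re_blockSymm_ge (T : q → q → ℂ) (comp : q → ℕ) (γ₀ : ℝ)
    (hT : ∀ w : q → ℂ, γ₀ * ∑ a, ‖w a‖ ^ 2 ≤ (∑ a, ∑ b, star (w a) * T a b * w b).re) (v : q → ℂ) :
    γ₀ * ∑ a, ‖v a‖ ^ 2 ≤
      (∑ a, star (v a) * ∑ b, (if comp a = comp b then ((1 / 2 : ℝ) : ℂ) * (T a b + T b a) else 0) * v b).re := by
  classical
  set M : Finset ℕ := Finset.univ.image comp with hM
  have hmem : ∀ a, comp a ∈ M := fun a => Finset.mem_image_of_mem comp (Finset.mem_univ a)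
  -- the component indicator vectors
  set vm : ℕ → q → ℂ := fun m a => if comp a = m then v a else 0 with hvm
  -- (A) ‖v‖² = Σ_m ‖v^m‖²
  have hA : ∑ a, ‖v a‖ ^ 2 = ∑ m ∈ M, ∑ a, ‖vm m a‖ ^ 2 := by
    rw [Finset.sum_comm]
    refine Finset.sum_congr rfl fun a _ => ?_
    have hn : ∀ m, ‖vm m a‖ ^ 2 = if comp a = m then ‖v a‖ ^ 2 else 0 := fun m => by
      by_cases h1 : comp a = m
      · simp only [hvm, if_pos h1]
      · simp only [hvm, if_neg h1, norm_zero]; norm_num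
    simp_rw [hn]
    rw [Finset.sum_ite_eq, if_pos (hmem a)]
  -- (B) the form = Σ_m of the symmetrised form at v^m
  have hterm : ∀ a b, star (v a) * ((if comp a = comp b then ((1 / 2 : ℝ) : ℂ) * (T a b + T b a) else 0) * v b) =
      ∑ m ∈ M, star (vm m a) * (((1 / 2 : ℝ) : ℂ) * (T a b + T b a)) * vm m b := by
    intro a b
    have hval : ∀ m, star (vm m a) * (((1 / 2 : ℝ) : ℂ) * (T a b + T b a)) * vm m b =
        if comp a = m ∧ comp b = m then star (v a) * (((1 / 2 : ℝ) : ℂ) * (T a b + T b a)) * v b else 0 := fun m => by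
      by_cases h1 : comp a = m
      · by_cases h2 : comp b = m
        · simp only [hvm, if_pos h1, if_pos h2, if_pos (And.intro h1 h2)]
        · simp only [hvm, if_pos h1, if_neg h2, mul_zero, if_neg (fun h : comp a = m ∧ comp b = m => h2 h.2)]
      · simp only [hvm, if_neg h1, star_zero, zero_mul, if_neg (fun h : comp a = m ∧ comp b = m => h1 h.1)]
    simp_rw [hval]
    by_cases hab : comp a = comp b
    · rw [if_pos hab]
      have hiff : ∀ m, (comp a = m ∧ comp b = m) ↔ comp b = m := fun m => by rw [hab]; exact and_self_iff
      simp_rw [hiff]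
      rw [Finset.sum_ite_eq, if_pos (hmem b)]
      ring
    · rw [if_neg hab, zero_mul, mul_zero]
      refine (Finset.sum_eq_zero fun m _ => ?_).symm
      rw [if_neg]
      rintro ⟨h1, h2⟩
      exact hab (h1.trans h2.symm)
  have hB : ∑ a, star (v a) * ∑ b, (if comp a = comp b then ((1 / 2 : ℝ) : ℂ) * (T a b + T b a) else 0) * v b =
      ∑ m ∈ M, ∑ a, ∑ b, star (vm m a) * (((1 / 2 : ℝ) : ℂ) * (T a b + T b a)) * vm m b := by
    calc ∑ a, star (v a) * ∑ b, (if comp a = comp b then ((1 / 2 : ℝ) : ℂ) * (T a b + T b a) else 0) * v b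
        = ∑ a, ∑ b, ∑ m ∈ M, star (vm m a) * (((1 / 2 : ℝ) : ℂ) * (T a b + T b a)) * vm m b := by
          refine Finset.sum_congr rfl fun a _ => ?_
          rw [Finset.mul_sum]
          exact Finset.sum_congr rfl fun b _ => hterm a b
      _ = ∑ a, ∑ m ∈ M, ∑ b, star (vm m a) * (((1 / 2 : ℝ) : ℂ) * (T a b + T b a)) * vm m b :=
          Finset.sum_congr rfl fun a _ => Finset.sum_comm
      _ = ∑ m ∈ M, ∑ a, ∑ b, star (vm m a) * (((1 / 2 : ℝ) : ℂ) * (T a b + T b a)) * vm m b := Finset.sum_comm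
  -- (C) per component: the symmetrised form at w is ½ReQ(w) + ½ReQ(w̄) ≥ γ₀‖w‖²
  have hC : ∀ w : q → ℂ, γ₀ * ∑ a, ‖w a‖ ^ 2 ≤ (∑ a, ∑ b, star (w a) * (((1 / 2 : ℝ) : ℂ) * (T a b + T b a)) * w b).re := by
    intro w
    rw [re_quadratic_symm]
    have h1 := hT w
    have h2 : γ₀ * ∑ a, ‖star (w a)‖ ^ 2 ≤ (∑ a, ∑ b, star (star (w a)) * T a b * star (w b)).re := hT (fun a => star (w a))
    have hn : ∑ a, ‖star (w a)‖ ^ 2 = ∑ a, ‖w a‖ ^ 2 := Finset.sum_congr rfl fun a _ => by rw [norm_star]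
    rw [hn] at h2
    linarith
  rw [hB, Complex.re_sum, hA, Finset.mul_sum]
  exact Finset.sum_le_sum fun m _ => hC (vm m)

end BlockSymm

/-! ## §4  (O4′) The B-acc bridge `P0ToRefAccBridge` HOLDS, and the bridge `B` of the node -/

/-- **THE DECORATED KERNEL AT `σ = 0`, `C := 1`, ENTRYWISE**: `decoratedOp Δ₀ J 1 0 u a b = [J(a,b) = ∅]·½Δ₀(u)_ab + [J(b,a) = ∅]·½Δ₀(u)_ba` — at `σ = 0` every decorated
pair drops (`∏_{k ∈ J ω} 0 = [J ω = ∅]`), and of the entrywise terms only `ω = (a,b)` (raw) and `ω = (b,a)` (transposed) see the entry `(a,b)`.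
[cite: Balaban1988RG2Cluster, (1.11) p.5, (2.5)–(2.8) pp.12–14; Balaban1985BackgroundPropagators, (3.107) p.416] -/
theorem decoratedOp_one_zero_apply {n₁ : ℕ} {q E : Type} [Fintype q] [DecidableEq q] (Δ₀ : E → Matrix q q ℂ) (J : q × q → Finset (TPt 4 n₁))
    (u : E) (a b : q) :
    decoratedOp Δ₀ J (1 : Matrix q q ℝ) 0 u a b =
      (if J (a, b) = ∅ then (1 / 2 : ℂ) * Δ₀ u a b else 0) + (if J (b, a) = ∅ then (1 / 2 : ℂ) * Δ₀ u b a else 0) := by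
  classical
  have hprod0 : ∀ s : Finset (TPt 4 n₁), (∏ _k ∈ s, (0 : ℂ)) = if s = ∅ then 1 else 0 := by
    intro s
    split_ifs with h
    · rw [h, Finset.prod_empty]
    · obtain ⟨x, hx⟩ := Finset.nonempty_iff_ne_empty.2 h
      exact Finset.prod_eq_zero hx rfl
  rw [decoratedOp_cm_one, B13Eq111SDecoupling.sDecorate_apply, tsum_fintype, Fintype.sum_sum_type]
  congr 1
  · rw [Finset.sum_eq_single (a, b)]
    · simp only [B13Eq111SDecoupling.sTerm_apply, Sum.elim_inl, id_eq, Pi.zero_apply, Matrix.smul_apply, smul_eq_mul,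
        B13EntrywiseWalks.rawEntryTerm, and_self, if_true, hprod0]
      split_ifs <;> simp
    · intro x _ hx
      have hne : ¬ (a = x.1 ∧ b = x.2) := fun h => hx (Prod.ext h.1.symm h.2.symm)
      simp only [B13Eq111SDecoupling.sTerm_apply, Sum.elim_inl, id_eq, Matrix.smul_apply, smul_eq_mul,
        B13EntrywiseWalks.rawEntryTerm, if_neg hne, mul_zero]
    · intro h; exact absurd (Finset.mem_univ _) h
  · rw [Finset.sum_eq_single (b, a)]
    · simp only [B13Eq111SDecoupling.sTerm_apply, Sum.elim_inr, id_eq, Pi.zero_apply, Matrix.smul_apply, Matrix.transpose_apply, smul_eq_mul,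
        B13EntrywiseWalks.rawEntryTerm, and_self, if_true, hprod0]
      split_ifs <;> simp
    · intro x _ hx
      have hne : ¬ (b = x.1 ∧ a = x.2) := fun h => hx (Prod.ext h.1.symm h.2.symm)
      simp only [B13Eq111SDecoupling.sTerm_apply, Sum.elim_inr, id_eq, Matrix.smul_apply, Matrix.transpose_apply, smul_eq_mul,
        B13EntrywiseWalks.rawEntryTerm, if_neg hne, mul_zero]
    · intro h; exact absurd (Finset.mem_univ _) h

/-- ★★★ **THE B-ACC BRIDGE HOLDS**: def-Y's DISPLAYED letter ✓`K0P0CarrierPins.P0ToRefAccBridge F …` INHABITED, exactly its type.  At `σ = 0` with `C := 1` the kernel is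
`[comp a = comp b]·½(T + Tᵀ)` with `T = TC n (cfg 0)∣window = Σ_{Y ⊆ Xref} T_Y(cfg 0)∣window` ((P4) sum + the letter's conditioning hypothesis); §3's
`re_blockSymm_ge` reduces `γ₀`-accretivity to `Re Q_T(w) ≥ γ₀‖w‖²` for every window vector `w`, which is (P5ᶜ) at `(X, φ) := (Xref, cfg 0)` applied to the `κ`-lift
`Function.extend κ w 0` (supported in `Xref` by the letter's `IdxInDom` hypothesis; sums re-indexed by injectivity).
[cite: Balaban1988RG2Cluster, (2.5)–(2.8) pp.12–14, p.15; Balaban1985Variational, Prop. 9 p.309; Balaban1987RG1, (2.11)–(2.12) pp.267–268] -/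
theorem p0ToRefAccBridge_holds :
    P0ToRefAccBridge F a₀ δ₀ c₀ γ₀ γ₁ Mc α₀ α₁ ε₂₉ k TC TY TZY AdM AdZ := by
  unfold P0ToRefAccBridge
  intro hP n n₁ E _ _ q _ _ κ cfg J comp Xref hκ hin hmem hJ hcond v
  classical
  obtain ⟨-, -, -, -, -, -, -, h8, -, -, -, -, h13⟩ := hP
  -- the window form of the conditioned carrier at the reference point
  set T : q → q → ℂ := fun a b =>
    ∑ Y ∈ Finset.univ.filter (fun Y : (recordDomSys F Mc k (recordK₀ F Mc k + n)).Dom => Y.1 ⊆ Xref.1), TY n Y (cfg 0) (κ a).1 (κ b).1 with hTdef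
  have hΔ : ∀ a b, deltaOfTC (TC n) cfg (fun a => (κ a).1) 0 a b = T a b := by
    intro a b
    rw [deltaOfTC_apply, h8]
    exact (Finset.sum_subset (Finset.filter_subset _ _) fun Y _ hY =>
      hcond Y a b fun h => hY (Finset.mem_filter.2 ⟨Finset.mem_univ _, h⟩)).symm
  -- the kernel at σ = 0
  have h2 : ((1 / 2 : ℝ) : ℂ) = 1 / 2 := by norm_num
  have hK : ∀ a b, decoratedOp (deltaOfTC (TC n) cfg fun a => (κ a).1) J (1 : Matrix q q ℝ) 0 0 a b =
      if comp a = comp b then ((1 / 2 : ℝ) : ℂ) * (T a b + T b a) else 0 := by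
    intro a b
    rw [decoratedOp_one_zero_apply, hΔ, hΔ]
    by_cases hab : comp a = comp b
    · rw [if_pos ((hJ a b).2 hab), if_pos ((hJ b a).2 hab.symm), if_pos hab, h2]; ring
    · rw [if_neg (fun h => hab ((hJ a b).1 h)), if_neg (fun h => hab ((hJ b a).1 h).symm), if_neg hab, add_zero]
  -- (P5ᶜ) at (Xref, cfg 0) on κ-lifts of window vectors
  have hT : ∀ w : q → ℂ, γ₀ * ∑ a, ‖w a‖ ^ 2 ≤ (∑ a, ∑ b, star (w a) * T a b * w b).re := by
    intro w
    set W : NonB0Idx F k (recordK₀ F Mc k + n) → ℂ := Function.extend κ w 0 with hW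
    have hWκ : ∀ a, W (κ a) = w a := fun a => hκ.extend_apply w 0 a
    have hWoff : ∀ i, (¬ ∃ a, κ a = i) → W i = 0 := fun i hi => by
      rw [hW, Function.extend_apply' w (0 : NonB0Idx F k (recordK₀ F Mc k + n) → ℂ) i hi, Pi.zero_apply]
    -- re-indexing of sums along the injective κ
    have hreidx : ∀ {M : Type} [AddCommMonoid M] (f : NonB0Idx F k (recordK₀ F Mc k + n) → ℂ → M), (∀ i, f i 0 = 0) →
        ∑ i, f i (W i) = ∑ a, f (κ a) (w a) := by
      intro M _ f hf
      have h1 : ∑ i, f i (W i) = ∑ i ∈ Finset.univ.image κ, f i (W i) :=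
        (Finset.sum_subset (Finset.subset_univ _) fun i _ hi => by
          rw [hWoff i (fun ⟨a, ha⟩ => hi (Finset.mem_image.2 ⟨a, Finset.mem_univ _, ha⟩)), hf]).symm
      rw [h1, Finset.sum_image (fun a _ b _ h => hκ h)]
      exact Finset.sum_congr rfl fun a _ => by rw [hWκ]
    have hsupp : ∀ i : NonB0Idx F k (recordK₀ F Mc k + n),
        B15DeterminingSets.embIter k i.1.1.src ∉ Sect2.domSites (F.P (recordK₀ F Mc k + n)) Mc (k + 1) Xref → W i = 0 := by
      intro i hi
      refine hWoff i ?_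
      rintro ⟨a, rfl⟩
      exact hi (hin a)
    have h5 := h13 n Xref (cfg 0) hmem W hsupp
    have hnorm : ∑ i, ‖W i‖ ^ 2 = ∑ a, ‖w a‖ ^ 2 := hreidx (fun _ z => ‖z‖ ^ 2) (fun _ => by simp)
    have hform : ∑ i, ∑ j, star (W i) *
        (∑ Y ∈ Finset.univ.filter (fun Y : (recordDomSys F Mc k (recordK₀ F Mc k + n)).Dom => Y.1 ⊆ Xref.1), TY n Y (cfg 0) i.1 j.1) * W j =
        ∑ a, ∑ b, star (w a) * T a b * w b := by
      have step1 := hreidx (fun i z => ∑ j, star z *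
        (∑ Y ∈ Finset.univ.filter (fun Y : (recordDomSys F Mc k (recordK₀ F Mc k + n)).Dom => Y.1 ⊆ Xref.1), TY n Y (cfg 0) i.1 j.1) * W j)
        (fun i => by simp)
      refine step1.trans (Finset.sum_congr rfl fun a _ => ?_)
      exact hreidx (fun j z => star (w a) *
        (∑ Y ∈ Finset.univ.filter (fun Y : (recordDomSys F Mc k (recordK₀ F Mc k + n)).Dom => Y.1 ⊆ Xref.1), TY n Y (cfg 0) (κ a).1 j.1) * z)
        (fun j => by simp)
    rw [hnorm, hform] at h5
    exact h5
  -- assemble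
  have hgoal : (∑ a, star (v a) * (decoratedOp (deltaOfTC (TC n) cfg fun a => (κ a).1) J (1 : Matrix q q ℝ) 0 0 *ᵥ v) a) =
      ∑ a, star (v a) * ∑ b, (if comp a = comp b then ((1 / 2 : ℝ) : ℂ) * (T a b + T b a) else 0) * v b := by
    refine Finset.sum_congr rfl fun a _ => ?_
    change star (v a) * (∑ b, decoratedOp (deltaOfTC (TC n) cfg fun a => (κ a).1) J (1 : Matrix q q ℝ) 0 0 a b * v b) = _
    simp_rw [hK]
  rw [hgoal]
  exact re_blockSymm_ge T comp γ₀ hT v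

/-- ★★ **THE BRIDGE `B` OF THE NODE HOLDS**: `P0ToN10KernelBridge F … = B-decay ∧ B-acc`, both halves inhabited above. [cite: Balaban1987RG1, (2.11)–(2.12) pp.267–268; Balaban1988RG2Cluster, (2.14) p.15] -/
theorem p0ToN10KernelBridge_holds :
    P0ToN10KernelBridge F a₀ δ₀ c₀ γ₀ γ₁ Mc α₀ α₁ ε₂₉ k TC TY TZY AdM AdZ :=
  ⟨p0ToEntryLettersBridge_holds F a₀ δ₀ c₀ γ₀ γ₁ Mc α₀ α₁ ε₂₉ k TC TY TZY AdM AdZ,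
    p0ToRefAccBridge_holds F a₀ δ₀ c₀ γ₀ γ₁ Mc α₀ α₁ ε₂₉ k TC TY TZY AdM AdZ⟩

end Summit.QuantumFields.YangMills.Theorems.K0P0ToEntryLettersBridgeHolds

end
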